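import Summits.KontsevichZagierPeriods.KontsevichZagierPeriods.Theses.HurwitzMicroSectors
import Summits.KontsevichZagierPeriods.KontsevichZagierPeriods.Theorems.HurwitzMicroSectorsNormalFormPrinciplePiBoxTransfer
import Summits.KontsevichZagierPeriods.KontsevichZagierPeriods.Theorems.HurwitzMicroSectorsNormalFormPrincipleVariants2238

/-! TTRL-lite variant V2272 of stmt-KontsevichZagierPeriods-3869

Variant V2272 = `stub_boxRigidity` (the leaf `BoxRigidity` of `NormalFormPrinciple`: two representations
on open unit boxes with integrands of KZ's rational shape `p/q` over `ℚ` and equal values are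
KZ-equivalent) under the move `fix_nat:m=4; bound_nat:m'≤4` (left dimension frozen to `4`, right
dimension `≤ 4`). Verdict of the attempt seat: **open** — this file is the exact-strength certificate,
not a proof of the variant. With `BoxVanishing K` := "a box-rational representation of dimension `K` and
value `0` is a relation" (the ladder of the siblings V2238, V2266, V2271):
* rigidity for the single pair of dimensions `(4, 0)` (allowed, `0 ≤ 4`) already gives `BoxVanishing 4`
  (compare a vanishing `N` with the zero representation on the `0`-box, itself a relation:
  `boxVanishingDim_left_of_pair 4 0`, tree);
* `BoxVanishing 4` gives rigidity for ALL `m, m' ≤ 4` (pad both to the `4`-box by unit intervals and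
  subtract there; the difference has value `0` by soundness: `boxRigidityLe_of_boxVanishingDim`, tree),
  of which V2272 is the slice `m = 4`.
Hence `V2272 ⟺ BoxVanishing 4 ⟺ BoxRigidity for m, m' ≤ 4 ⟺ V2271 ⟺ V2266`
(`stub_boxRigidity_var2272_iff_boxVanishing_four`, `stub_boxRigidity_var2272_iff_le_four`,
`stub_boxRigidity_var2272_iff_var2271`, `stub_boxRigidity_var2272_iff_var2266`): the bound `m' ≤ 4` is
idle once `m = 4` is frozen. V2272 implies `BoxVanishing j` for every `j ≤ 4`
(`boxVanishing_le_four_of_stub_boxRigidity_var2272`); `BoxVanishing 1` is a theorem of the tree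
(`boxRigidity_of_le_one`, Baker), `BoxVanishing 2` already asserts that EVERY vanishing box-rational
`∫_{(0,1)²} P/Q` (differences of representations of `π²`, Catalan's `G`, `Li₂` at rationals,
`log a · log b`, `L(2,χ)`, …) is generated by the four moves — e.g. for every `a : ℚ` the instance
"`G = a·π² ⇒ [1/(1 + x²y²) − 6a/(1 − xy)]_{□²} ∈ relations`", decided today by no theorem — and
`BoxVanishing 4` (`ζ(3)`, `π⁴`, `β(4)`, `Li₄` values, Euler's `ζ(3,1) = ζ(4)/4`, …) contains it. Conversely
`KontsevichZagierPeriods → V2272` (`stub_boxRigidity_var2272_of_statement`), so a refutation of the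
variant would refute the Summit; the tree has no invariant of `KZ.relations` finer than `eval`, so
neither side is reachable here.
Source: M. Kontsevich, D. Zagier, *Periods* (2001), §1.2 Conjecture 1. Pure proof file, no definitions. -/

-- `Summit.<Summit>.<Problem>` is the tree's mandated summit-side namespace (CONVENTIONS §2); for this
-- single-conjunct summit the two coincide, so the duplicate is deliberate.
set_option linter.dupNamespace false

noncomputable section

namespace Summit.KontsevichZagierPeriods.KontsevichZagierPeriods.Theorems

open MeasureTheory Set
open Literature.NumberTheory.Transcendental Literature.NumberTheory.Transcendental.KZ
open Summit.KontsevichZagierPeriods.KontsevichZagierPeriods.Theses.HurwitzMicroSectors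
open Summit.KontsevichZagierPeriods.HurwitzMicroSectors.NormalFormPrinciple.PiBox

/-! ## The variant V2272: exactly `BoxVanishing 4` -/

/-- **V2272 ⟺ `BoxVanishing 4`**: (⇒) the pair `(4, 0)` is allowed (`0 ≤ 4`), so
`boxVanishingDim_left_of_pair 4 0`; (⇐) `boxRigidityLe_of_boxVanishingDim 4` with `m = 4`, `m' ≤ 4`.
[cite: KontsevichZagier2001, §1.2 Conjecture 1] -/
theorem stub_boxRigidity_var2272_iff_boxVanishing_four :
    (∀ (m' : ℕ) (N : IntegralRep 4) (N' : IntegralRep m'), m' ≤ 4 → N.domain = {x | ∀ i, x i ∈ Set.Ioo (0:ℝ) 1} → N.IsRational → N'.domain = {x | ∀ i, x i ∈ Set.Ioo (0:ℝ) 1} → N'.IsRational → N.value = N'.value → Equivalent N N') ↔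
    (∀ (M : IntegralRep 4), M.domain = {x | ∀ i, x i ∈ Set.Ioo (0:ℝ) 1} → M.IsRational →
      M.value = 0 → of M ∈ relations) :=
  ⟨fun h => boxVanishingDim_left_of_pair 4 0 fun N N' => h 0 N N' (Nat.zero_le 4),
    fun hvan m' N N' hm' => boxRigidityLe_of_boxVanishingDim 4 hvan 4 m' N N' le_rfl hm'⟩

/-- **V2272 ⟺ `BoxRigidity` for all `m, m' ≤ 4`** (the frozen `m = 4` may be relaxed to `m ≤ 4`: pad).
[cite: KontsevichZagier2001, §1.2 Conjecture 1] -/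
theorem stub_boxRigidity_var2272_iff_le_four :
    (∀ (m' : ℕ) (N : IntegralRep 4) (N' : IntegralRep m'), m' ≤ 4 → N.domain = {x | ∀ i, x i ∈ Set.Ioo (0:ℝ) 1} → N.IsRational → N'.domain = {x | ∀ i, x i ∈ Set.Ioo (0:ℝ) 1} → N'.IsRational → N.value = N'.value → Equivalent N N') ↔
    (∀ (m m' : ℕ) (N : IntegralRep m) (N' : IntegralRep m'), m ≤ 4 → m' ≤ 4 →
      N.domain = {x | ∀ i, x i ∈ Set.Ioo (0:ℝ) 1} → N.IsRational →
      N'.domain = {x | ∀ i, x i ∈ Set.Ioo (0:ℝ) 1} → N'.IsRational →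
      N.value = N'.value → Equivalent N N') := by
  rw [stub_boxRigidity_var2272_iff_boxVanishing_four]
  exact ⟨fun hvan => boxRigidityLe_of_boxVanishingDim 4 hvan,
    fun h M => boxVanishingDim_left_of_pair 4 4 (fun N N' => h 4 4 N N' le_rfl le_rfl) M⟩

/-- **V2272 ⟺ V2271** (`fix_nat:m=4; bound_nat:m'≤4` and `fix_nat:m=4; fix_nat:m'=4` have the same
strength, `BoxVanishing 4`; proved directly from the ladder lemmas, so this file does not import the
sibling certificate `…Variants2271`). [cite: KontsevichZagier2001, §1.2 Conjecture 1] -/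
theorem stub_boxRigidity_var2272_iff_var2271 :
    (∀ (m' : ℕ) (N : IntegralRep 4) (N' : IntegralRep m'), m' ≤ 4 → N.domain = {x | ∀ i, x i ∈ Set.Ioo (0:ℝ) 1} → N.IsRational → N'.domain = {x | ∀ i, x i ∈ Set.Ioo (0:ℝ) 1} → N'.IsRational → N.value = N'.value → Equivalent N N') ↔
    (∀ (N : IntegralRep 4) (N' : IntegralRep 4), N.domain = {x | ∀ i, x i ∈ Set.Ioo (0:ℝ) 1} → N.IsRational → N'.domain = {x | ∀ i, x i ∈ Set.Ioo (0:ℝ) 1} → N'.IsRational → N.value = N'.value → Equivalent N N') := by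
  rw [stub_boxRigidity_var2272_iff_boxVanishing_four]
  exact ⟨fun hvan N N' => boxRigidityLe_of_boxVanishingDim 4 hvan 4 4 N N' le_rfl le_rfl,
    fun h => boxVanishingDim_left_of_pair 4 4 h⟩

/-- **V2272 ⟺ V2266** (`fix_nat:m=4; bound_nat:m'≤4` and `fix_nat:m=4; bound_nat:m'≤2` have the same
strength, `BoxVanishing 4`; proved directly from the ladder lemmas, so this file does not import the
sibling certificate `…Variants2266`). [cite: KontsevichZagier2001, §1.2 Conjecture 1] -/
theorem stub_boxRigidity_var2272_iff_var2266 :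
    (∀ (m' : ℕ) (N : IntegralRep 4) (N' : IntegralRep m'), m' ≤ 4 → N.domain = {x | ∀ i, x i ∈ Set.Ioo (0:ℝ) 1} → N.IsRational → N'.domain = {x | ∀ i, x i ∈ Set.Ioo (0:ℝ) 1} → N'.IsRational → N.value = N'.value → Equivalent N N') ↔
    (∀ (m' : ℕ) (N : IntegralRep 4) (N' : IntegralRep m'), m' ≤ 2 → N.domain = {x | ∀ i, x i ∈ Set.Ioo (0:ℝ) 1} → N.IsRational → N'.domain = {x | ∀ i, x i ∈ Set.Ioo (0:ℝ) 1} → N'.IsRational → N.value = N'.value → Equivalent N N') := by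
  rw [stub_boxRigidity_var2272_iff_boxVanishing_four]
  exact ⟨fun hvan m' N N' hm' =>
      boxRigidityLe_of_boxVanishingDim 4 hvan 4 m' N N' le_rfl (hm'.trans (by norm_num)),
    fun h => boxVanishingDim_left_of_pair 4 0 fun N N' => h 0 N N' (Nat.zero_le 2)⟩

/-- **V2272 ⇒ `BoxVanishing` in every dimension `≤ 4`** (monotonicity of `BoxVanishing`,
`boxVanishingDim_mono`): in particular the dimension-`2` statement that every vanishing box-rational
`∫_{(0,1)²} P/Q` is generated by the moves. [cite: KontsevichZagier2001, §1.2 Conjecture 1] -/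
theorem boxVanishing_le_four_of_stub_boxRigidity_var2272
    (h : ∀ (m' : ℕ) (N : IntegralRep 4) (N' : IntegralRep m'), m' ≤ 4 → N.domain = {x | ∀ i, x i ∈ Set.Ioo (0:ℝ) 1} → N.IsRational → N'.domain = {x | ∀ i, x i ∈ Set.Ioo (0:ℝ) 1} → N'.IsRational → N.value = N'.value → Equivalent N N')
    {j : ℕ} (hj : j ≤ 4) (N : IntegralRep j) (hNd : N.domain = {x | ∀ i, x i ∈ Set.Ioo (0:ℝ) 1})
    (hNr : N.IsRational) (hv : N.value = 0) : of N ∈ relations :=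
  boxVanishingDim_mono hj (stub_boxRigidity_var2272_iff_boxVanishing_four.1 h) N hNd hNr hv

/-- **V2271 ⇒ V2272** (the fully frozen sibling already gives the bounded one).
[cite: KontsevichZagier2001, §1.2 Conjecture 1] -/
theorem stub_boxRigidity_var2272_of_var2271
    (h : ∀ (N : IntegralRep 4) (N' : IntegralRep 4), N.domain = {x | ∀ i, x i ∈ Set.Ioo (0:ℝ) 1} → N.IsRational → N'.domain = {x | ∀ i, x i ∈ Set.Ioo (0:ℝ) 1} → N'.IsRational → N.value = N'.value → Equivalent N N') :
    ∀ (m' : ℕ) (N : IntegralRep 4) (N' : IntegralRep m'), m' ≤ 4 → N.domain = {x | ∀ i, x i ∈ Set.Ioo (0:ℝ) 1} → N.IsRational → N'.domain = {x | ∀ i, x i ∈ Set.Ioo (0:ℝ) 1} → N'.IsRational → N.value = N'.value → Equivalent N N' :=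
  stub_boxRigidity_var2272_iff_var2271.2 h

/-- **The parent leaf ⇒ V2272** (specialisation `m = 4`; the bound `m' ≤ 4` is dropped).
[cite: KontsevichZagier2001, §1.2 Conjecture 1] -/
theorem stub_boxRigidity_var2272_of_parent
    (h : ∀ (m m' : ℕ) (N : IntegralRep m) (N' : IntegralRep m'), N.domain = {x | ∀ i, x i ∈ Set.Ioo (0:ℝ) 1} → N.IsRational → N'.domain = {x | ∀ i, x i ∈ Set.Ioo (0:ℝ) 1} → N'.IsRational → N.value = N'.value → Equivalent N N') :
    ∀ (m' : ℕ) (N : IntegralRep 4) (N' : IntegralRep m'), m' ≤ 4 → N.domain = {x | ∀ i, x i ∈ Set.Ioo (0:ℝ) 1} → N.IsRational → N'.domain = {x | ∀ i, x i ∈ Set.Ioo (0:ℝ) 1} → N'.IsRational → N.value = N'.value → Equivalent N N' :=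
  fun m' N N' _ => h 4 m' N N'

/-- **`KontsevichZagierPeriods ⇒ V2272`**: the variant is a special case of Conjecture 1 for the tree's
calculus (`leaves_of_statement`) — so a refutation of the variant would refute the Summit.
[cite: KontsevichZagier2001, §1.2 Conjecture 1] -/
theorem stub_boxRigidity_var2272_of_statement (h : _root_.KontsevichZagierPeriods) :
    ∀ (m' : ℕ) (N : IntegralRep 4) (N' : IntegralRep m'), m' ≤ 4 → N.domain = {x | ∀ i, x i ∈ Set.Ioo (0:ℝ) 1} → N.IsRational → N'.domain = {x | ∀ i, x i ∈ Set.Ioo (0:ℝ) 1} → N'.IsRational → N.value = N'.value → Equivalent N N' :=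
  stub_boxRigidity_var2272_of_parent (leaves_of_statement h).1

end Summit.KontsevichZagierPeriods.KontsevichZagierPeriods.Theorems

end
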